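import Mathlib
import Literature.NumberTheory.Transcendental.SemialgebraicMapsProofs
import Literature.NumberTheory.Transcendental.SemialgebraicVolume
import Literature.ModelTheory.ExponentialFields.SemialgebraicInterior
import Literature.NumberTheory.Transcendental.KZGroundingRelations

/-!
# Crux `SymplecticScissors.PlanarSAZylev` (stmt-KontsevichZagierPeriods-9848),
line `reservoir-peeling`, stub `stub_groundLast`: symplectic grounding of the last coordinate

The pinned relation `E A B` says: an open co-null `ℚ`-semialgebraic part `U` of `A` is carried by
one `ℚ`-semialgebraic `C¹` injection `Φ` with `|det DΦ| = 1` onto a co-null part of `B`.  We prove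
that a `ℚ`-semialgebraic planar region `S` of finite area is `E`-equivalent to its grounding
`Grounding.groundLast S = {(x, t) | 0 < t < length S_x}`, GIVEN (as hypotheses, proved by the
neighbouring stubs) gluing, transitivity, the two co-null-subset instances of `E`, and the
stacking of finitely many ordered bands over an open subset of the line (`stub_groundCell`).

Proof (the bookkeeping of `KZ.of_sub_of_mem_relations_groundLast` /
`KZ.of_sub_of_mem_relations_cell`, with `E` in place of the KZ relations).  Take a cylindrical
decomposition of the line adapted to `S`
(`IsSemialgebraic.exists_cylindricalDecomposition.exists_fibre_eq`, Basu–Pollack–Roy 2006,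
Cor. 5.7, proved in the tree): over each cell `C` the set `S` is a finite union of graphs and
bands of continuous `ℚ`-semialgebraic sections `ξ_{C,0} < ⋯ < ξ_{C,ℓ-1}`.

* `groundLast_cell` — over ONE cell `C`: if `vol C = 0` both `S ∩ (C × ℝ)` and
  `groundLast S ∩ (C × ℝ)` are null and `E ∅ ∅`; otherwise every band of `S` over `C` is inner
  (`KZ.ne_zero_and_ne_last_of_bandOver_subset`), the bands over the INTERIOR `C'` of `C`
  (co-null in `C`: semialgebraic frontiers are null), enumerated increasingly
  (`groundLast_enum`, `Finset.orderEmbOfFin`), are stacked by the hypothesis `CELL` onto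
  `T_C = {(x, t) | x ∈ C', 0 < t < Σ widths}`, and `T_C = groundLast S ∩ (C' × ℝ)` because the
  fibre length is the total width (`KZ.volume_fibre_eq_ofReal_sum`); the discarded parts of
  `S ∩ (C × ℝ)` (graphs, the cylinder over `C \ C'`) and of `groundLast S ∩ (C × ℝ)` are null.
* `groundLast_glue` — gluing finitely many instances with a.e.-disjoint sources and disjoint
  targets (iterating the hypothesis `GLUE`).
* `stub_groundLast` — glue the cells (different cylinders are disjoint), then
  `S ~ ⋃ W_C ~ ⋃ T_C ~ groundLast S` by the co-null-subset instances and transitivity.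

Sources: S. Basu, R. Pollack, M.-F. Roy, *Algorithms in Real Algebraic Geometry* (2006),
Cor. 5.7 (cylindrical decomposition, tree file `CylindricalDecomposition.lean`); the rest is
folklore measure-theoretic bookkeeping.  No new definitions.
-/

noncomputable section

open MeasureTheory Set
open Literature.NumberTheory.Transcendental Literature.ModelTheory.ExponentialFields

namespace Summit.KontsevichZagierPeriods.SymplecticScissors.PlanarSAZylev

/-- **Increasing enumeration of a finite set** (`Finset.orderEmbOfFin`, repackaged): a finite
subset `B` of a linear order is the range of a strictly increasing map `e : Fin |B| → α`, and
sums over `B` are sums over `Fin |B|` through `e`. [folklore] -/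
theorem groundLast_enum {α : Type*} [LinearOrder α] (B : Finset α) :
    ∃ e : Fin B.card → α, (∀ i, e i ∈ B) ∧ StrictMono e ∧ (∀ j ∈ B, ∃ i, e i = j) ∧
      ∀ F : α → ℝ, ∑ i, F (e i) = ∑ j ∈ B, F j := by
  refine ⟨B.orderEmbOfFin rfl, fun i => B.orderEmbOfFin_mem rfl i, (B.orderEmbOfFin rfl).strictMono,
    fun j hj => ?_, fun F => ?_⟩
  · have h : j ∈ Set.range (B.orderEmbOfFin rfl) := by rw [Finset.range_orderEmbOfFin]; exact hj
    exact h
  · have h := Finset.sum_map Finset.univ (B.orderEmbOfFin rfl).toEmbedding F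
    rw [Finset.map_orderEmbOfFin_univ] at h
    rw [h]
    rfl

/-- **Gluing finitely many instances.** If `E ∅ ∅` and `E` glues two instances with
a.e.-disjoint sources and disjoint targets, then it glues finitely many: for sources `W i` with
pairwise null intersections and pairwise disjoint targets `T i` (`i ∈ s`), `E (W i) (T i)` for all
`i ∈ s` gives `E (⋃ i ∈ s, W i) (⋃ i ∈ s, T i)`. [folklore] -/
theorem groundLast_glue {ι : Type*} (E : Set (Fin 2 → ℝ) → Set (Fin 2 → ℝ) → Prop) (h0 : E ∅ ∅)
    (hglue : ∀ A₁ A₂ B₁ B₂ : Set (Fin 2 → ℝ), volume (A₁ ∩ A₂) = 0 → Disjoint B₁ B₂ →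
      E A₁ B₁ → E A₂ B₂ → E (A₁ ∪ A₂) (B₁ ∪ B₂))
    (W T : ι → Set (Fin 2 → ℝ)) (s : Finset ι)
    (hW : ∀ i ∈ s, ∀ i' ∈ s, i ≠ i' → volume (W i ∩ W i') = 0)
    (hT : ∀ i ∈ s, ∀ i' ∈ s, i ≠ i' → Disjoint (T i) (T i'))
    (hE : ∀ i ∈ s, E (W i) (T i)) :
    E (⋃ i ∈ s, W i) (⋃ i ∈ s, T i) := by
  classical
  induction s using Finset.induction_on with
  | empty => simpa using h0
  | insert a s ha ih =>
    rw [Finset.set_biUnion_insert, Finset.set_biUnion_insert]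
    have has : ∀ i ∈ s, a ≠ i := fun i hi h => ha (h ▸ hi)
    have haW : volume (W a ∩ ⋃ i ∈ s, W i) = 0 := by
      rw [inter_iUnion₂]
      exact (measure_biUnion_null_iff s.countable_toSet).2 fun i hi =>
        hW a (Finset.mem_insert_self a s) i (Finset.mem_insert_of_mem hi) (has i hi)
    have haT : Disjoint (T a) (⋃ i ∈ s, T i) :=
      disjoint_iUnion₂_right.2 fun i hi =>
        hT a (Finset.mem_insert_self a s) i (Finset.mem_insert_of_mem hi) (has i hi)
    exact hglue _ _ _ _ haW haT (hE a (Finset.mem_insert_self a s))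
      (ih (fun i hi i' hi' => hW i (Finset.mem_insert_of_mem hi) i' (Finset.mem_insert_of_mem hi'))
        (fun i hi i' hi' => hT i (Finset.mem_insert_of_mem hi) i' (Finset.mem_insert_of_mem hi'))
        fun i hi => hE i (Finset.mem_insert_of_mem hi))

/-- **Grounding over one cell.** Let `S ⊆ ℝ²` be `ℚ`-semialgebraic of finite area and `C` a
`ℚ`-semialgebraic cell of the line carrying continuous `ℚ`-semialgebraic increasing sections `ξ`
over which the vertical fibres of `S` are the graphs `j ∈ G` and the bands `j ∈ B` (the output of
an adapted cylindrical decomposition).  Then there are `ℚ`-semialgebraic `W ⊆ S ∩ (C × ℝ)` and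
`T ⊆ groundLast S ∩ (C × ℝ)`, both co-null there, with `E W T`: for `vol C = 0` take `W = T = ∅`;
otherwise all bands are inner (`KZ.ne_zero_and_ne_last_of_bandOver_subset`), `W` is the union of
the bands over the interior `C'` of `C`, stacked by `CELL` onto
`T = {(x, t) | x ∈ C', 0 < t < Σ_j (ξ_j x − ξ_{j-1} x)} = groundLast S ∩ (C' × ℝ)`
(`KZ.volume_fibre_eq_ofReal_sum`); graphs, and cylinders over the null set `C \ C'`, are null.
[folklore] -/
theorem groundLast_cell (E : Set (Fin 2 → ℝ) → Set (Fin 2 → ℝ) → Prop)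
    (SUB : ∀ A A' : Set (Fin 2 → ℝ), A' ⊆ A → IsSemialgebraic ℚ A' → volume (A \ A') = 0 →
      E A A' ∧ E A' A)
    (CELL : ∀ (k : ℕ) (C : Set (Fin 1 → ℝ)) (f g : Fin k → (Fin 1 → ℝ) → ℝ),
      IsOpen C → IsSemialgebraic ℚ C →
      (∀ i, IsSemialgebraicFunOn ℚ C (f i)) → (∀ i, IsSemialgebraicFunOn ℚ C (g i)) →
      (∀ i, ContinuousOn (f i) C) → (∀ i, ContinuousOn (g i) C) →
      (∀ i, ∀ x ∈ C, f i x < g i x) →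
      (∀ i i', i < i' → ∀ x ∈ C, g i x ≤ f i' x) →
      E (⋃ i, {z : Fin 2 → ℝ | Fin.init z ∈ C ∧ f i (Fin.init z) < z (Fin.last 1) ∧
            z (Fin.last 1) < g i (Fin.init z)})
        {z : Fin 2 → ℝ | Fin.init z ∈ C ∧ 0 < z (Fin.last 1) ∧
            z (Fin.last 1) < ∑ i, (g i (Fin.init z) - f i (Fin.init z))})
    {l : ℕ} {S : Set (Fin 2 → ℝ)} (hS : IsSemialgebraic ℚ S) (hfin : volume S ≠ ⊤)
    {C : Set (Fin 1 → ℝ)} (hC : IsSemialgebraic ℚ C) (ξ : Fin l → (Fin 1 → ℝ) → ℝ)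
    (hcont : ∀ j, ContinuousOn (ξ j) C) (hξ : ∀ j, IsSemialgebraicFunOn ℚ C (ξ j))
    (hmono : ∀ x ∈ C, StrictMono fun j => ξ j x)
    (hBsa : ∀ j, IsSemialgebraic ℚ (bandOver C ξ j))
    (hfib : ∃ (G : Finset (Fin l)) (B : Finset (Fin (l + 1))),
      (∀ j ∈ G, graphOver C (ξ j) ⊆ S) ∧ (∀ j ∈ B, bandOver C ξ j ⊆ S) ∧
        ∀ x ∈ C, {t : ℝ | (Fin.snoc x t : Fin 2 → ℝ) ∈ S} =
          (⋃ j ∈ G, {ξ j x}) ∪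
            ⋃ j ∈ B, {t : ℝ | bandLower ξ j x < t ∧ (t : EReal) < bandUpper ξ j x}) :
    ∃ W T : Set (Fin 2 → ℝ), W ⊆ S ∩ {z | Fin.init z ∈ C} ∧ IsSemialgebraic ℚ W ∧
      volume ((S ∩ {z | Fin.init z ∈ C}) \ W) = 0 ∧
      T ⊆ Grounding.groundLast S ∩ {z | Fin.init z ∈ C} ∧ IsSemialgebraic ℚ T ∧
      volume ((Grounding.groundLast S ∩ {z | Fin.init z ∈ C}) \ T) = 0 ∧ E W T := by
  -- adapted from `KZ.of_sub_of_mem_relations_cell`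
  -- (Literature/NumberTheory/Transcendental/KZGroundingRelations.lean)
  classical
  obtain ⟨G, B, -, hBsub, hfibx⟩ := hfib
  have hSm : MeasurableSet S := IsSemialgebraic.measurableSet_holds hS
  have hCm : MeasurableSet C := IsSemialgebraic.measurableSet_holds hC
  have h00 : E ∅ ∅ := (SUB ∅ ∅ (empty_subset _) isSemialgebraic_empty (by simp)).1
  by_cases hC0 : volume C = 0
  · -- both pieces are null
    have hcyl : volume {z : Fin 2 → ℝ | Fin.init z ∈ C} = 0 := KZ.volume_setOf_init_mem_eq_zero hC0
    refine ⟨∅, ∅, empty_subset _, isSemialgebraic_empty, ?_, empty_subset _, isSemialgebraic_empty,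
      ?_, h00⟩
    · rw [Set.sdiff_empty]; exact measure_mono_null inter_subset_right hcyl
    · rw [Set.sdiff_empty]; exact measure_mono_null inter_subset_right hcyl
  -- all bands over `C` are inner
  have hinner : ∀ j ∈ B, j ≠ 0 ∧ j ≠ Fin.last l := fun j hj =>
    KZ.ne_zero_and_ne_last_of_bandOver_subset hSm hfin hCm hC0 ξ (hBsub j hj)
  have hIoo : ∀ j ∈ B, ∀ (x : Fin 1 → ℝ) (t : ℝ),
      (bandLower ξ j x < (t : EReal) ∧ (t : EReal) < bandUpper ξ j x) ↔
        ((bandLower ξ j x).toReal < t ∧ t < (bandUpper ξ j x).toReal) := by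
    intro j hj x t
    have h := Set.ext_iff.1 (KZ.bandFibre_eq_Ioo ξ (hinner j hj).1 (hinner j hj).2 x) t
    simpa only [mem_setOf_eq, mem_Ioo] using h
  -- the interior of the cell
  obtain ⟨C', hC'def⟩ : ∃ C' : Set (Fin 1 → ℝ), C' = interior C := ⟨_, rfl⟩
  have hC'C : C' ⊆ C := hC'def ▸ interior_subset
  have hC'o : IsOpen C' := hC'def ▸ isOpen_interior
  have hC'sa : IsSemialgebraic ℚ C' := hC'def ▸ isSemialgebraic_interior hC
  have hnull : volume {z : Fin 2 → ℝ | Fin.init z ∈ C \ C'} = 0 := by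
    refine KZ.volume_setOf_init_mem_eq_zero (measure_mono_null (fun x hx => ?_)
      (volume_frontier_eq_zero_of_isSemialgebraic hC))
    exact ⟨subset_closure hx.1, hC'def ▸ hx.2⟩
  -- enumerate the bands increasingly and name their boundaries
  obtain ⟨e, heB, hemono, herange, hesum⟩ := groundLast_enum B
  obtain ⟨f, hf⟩ : ∃ f : Fin B.card → (Fin 1 → ℝ) → ℝ,
      f = fun i x => (bandLower ξ (e i) x).toReal := ⟨_, rfl⟩
  obtain ⟨g, hg⟩ : ∃ g : Fin B.card → (Fin 1 → ℝ) → ℝ,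
      g = fun i x => (bandUpper ξ (e i) x).toReal := ⟨_, rfl⟩
  have hf' : ∀ i x, f i x = ξ ((e i).pred (hinner _ (heB i)).1) x := fun i x => by
    simp only [hf, bandLower_of_ne_zero ξ (e i) (hinner _ (heB i)).1, EReal.toReal_coe]
  have hg' : ∀ i x, g i x = ξ ((e i).castPred (hinner _ (heB i)).2) x := fun i x => by
    simp only [hg, bandUpper_of_ne_last ξ (e i) (hinner _ (heB i)).2, EReal.toReal_coe]
  -- the hypotheses of `CELL` over `C'`
  have hfsa : ∀ i, IsSemialgebraicFunOn ℚ C' (f i) := fun i =>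
    ((hξ _).mono hC'C hC'sa).congr fun x _ => (hf' i x).symm
  have hgsa : ∀ i, IsSemialgebraicFunOn ℚ C' (g i) := fun i =>
    ((hξ _).mono hC'C hC'sa).congr fun x _ => (hg' i x).symm
  have hfc : ∀ i, ContinuousOn (f i) C' := fun i =>
    ((hcont _).mono hC'C).congr fun x _ => hf' i x
  have hgc : ∀ i, ContinuousOn (g i) C' := fun i =>
    ((hcont _).mono hC'C).congr fun x _ => hg' i x
  have hfg : ∀ i, ∀ x ∈ C', f i x < g i x := fun i x hx => by
    rw [hf, hg]
    exact KZ.toReal_bandLower_lt_toReal_bandUpper ξ (hmono x (hC'C hx)) (hinner _ (heB i)).1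
      (hinner _ (heB i)).2
  have hgf : ∀ i i', i < i' → ∀ x ∈ C', g i x ≤ f i' x := fun i i' hii' x hx => by
    rw [hf, hg]
    refine EReal.toReal_le_toReal
      (KZ.bandUpper_le_bandLower_of_lt ξ (hmono x (hC'C hx)) (hemono hii')) ?_ ?_
    · rw [bandUpper_of_ne_last ξ _ (hinner _ (heB i)).2]; exact EReal.coe_ne_bot _
    · rw [bandLower_of_ne_zero ξ _ (hinner _ (heB i')).1]; exact EReal.coe_ne_top _
  have hcell := CELL B.card C' f g hC'o hC'sa hfsa hgsa hfc hgc hfg hgf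
  -- the fibre length over `C` is the total width
  have hlen : ∀ x ∈ C, volume (FibreLength.fibre S x) = ENNReal.ofReal (∑ i, (g i x - f i x)) := by
    intro x hx
    rw [KZ.volume_fibre_eq_ofReal_sum ξ (hmono x hx) G B hinner (hfibx x hx),
      ← hesum fun j => (bandUpper ξ j x).toReal - (bandLower ξ j x).toReal]
    simp only [hf, hg]
  -- the target is `groundLast S` over `C'`
  have hTeq : {z : Fin 2 → ℝ | Fin.init z ∈ C' ∧ 0 < z (Fin.last 1) ∧
      z (Fin.last 1) < ∑ i, (g i (Fin.init z) - f i (Fin.init z))} =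
      Grounding.groundLast S ∩ {z | Fin.init z ∈ C'} := by
    ext z
    simp only [mem_setOf_eq, mem_inter_iff, Grounding.mem_groundLast_iff]
    constructor
    · rintro ⟨hzC', h0, hlt⟩
      refine ⟨⟨h0, ?_⟩, hzC'⟩
      rw [hlen _ (hC'C hzC')]
      exact (ENNReal.ofReal_lt_ofReal_iff_of_nonneg h0.le).2 hlt
    · rintro ⟨⟨h0, hlt⟩, hzC'⟩
      refine ⟨hzC', h0, ?_⟩
      rw [hlen _ (hC'C hzC')] at hlt
      exact (ENNReal.ofReal_lt_ofReal_iff_of_nonneg h0.le).1 hlt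
  -- the pieces of the source are the bands over `C'`
  have hpiece : ∀ i, {z : Fin 2 → ℝ | Fin.init z ∈ C' ∧ f i (Fin.init z) < z (Fin.last 1) ∧
      z (Fin.last 1) < g i (Fin.init z)} =
      {z : Fin 2 → ℝ | Fin.init z ∈ C'} ∩ bandOver C ξ (e i) := by
    intro i
    ext z
    simp only [mem_setOf_eq, mem_inter_iff, mem_bandOver_iff, hf, hg]
    rw [hIoo _ (heB i)]
    exact ⟨fun h => ⟨h.1, hC'C h.1, h.2⟩, fun h => ⟨h.1, h.2.2⟩⟩
  refine ⟨⋃ i, {z : Fin 2 → ℝ | Fin.init z ∈ C' ∧ f i (Fin.init z) < z (Fin.last 1) ∧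
      z (Fin.last 1) < g i (Fin.init z)},
    {z : Fin 2 → ℝ | Fin.init z ∈ C' ∧ 0 < z (Fin.last 1) ∧
      z (Fin.last 1) < ∑ i, (g i (Fin.init z) - f i (Fin.init z))}, ?_, ?_, ?_, ?_, ?_, ?_, hcell⟩
  · -- `W ⊆ S ∩ (C × ℝ)`
    refine iUnion_subset fun i => ?_
    rw [hpiece i]
    exact fun z hz => ⟨hBsub _ (heB i) hz.2, hC'C hz.1⟩
  · -- `W` is semialgebraic
    have h := IsSemialgebraic.biUnion Finset.univ
      (fun i => {z : Fin 2 → ℝ | Fin.init z ∈ C'} ∩ bandOver C ξ (e i))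
      fun i _ => hC'sa.setOf_init_mem.inter (hBsa (e i))
    simp only [Finset.mem_univ, iUnion_true] at h
    simpa only [hpiece] using h
  · -- `S ∩ (C × ℝ) \ W` is null: graphs and the cylinder over `C \ C'`
    have hsub : (S ∩ {z | Fin.init z ∈ C}) \ (⋃ i, {z : Fin 2 → ℝ | Fin.init z ∈ C' ∧
        f i (Fin.init z) < z (Fin.last 1) ∧ z (Fin.last 1) < g i (Fin.init z)}) ⊆
        {z | Fin.init z ∈ C \ C'} ∪
          ⋃ j ∈ G, {z : Fin 2 → ℝ | Fin.init z ∈ C ∧ z (Fin.last 1) = ξ j (Fin.init z)} := by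
      rintro z ⟨⟨hzS, hzC⟩, hzW⟩
      have hzC : Fin.init z ∈ C := hzC
      by_cases hzC' : Fin.init z ∈ C'
      · right
        have ht : z (Fin.last 1) ∈ {t : ℝ | (Fin.snoc (Fin.init z) t : Fin 2 → ℝ) ∈ S} := by
          show Fin.snoc (Fin.init z) (z (Fin.last 1)) ∈ S
          rw [Fin.snoc_init_self]; exact hzS
        rw [hfibx _ hzC] at ht
        rcases ht with ht | ht
        · simp only [mem_iUnion, mem_singleton_iff, exists_prop] at ht
          obtain ⟨j, hj, hjt⟩ := ht
          exact mem_iUnion₂.2 ⟨j, hj, hzC, hjt⟩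
        · simp only [mem_iUnion, mem_setOf_eq, exists_prop] at ht
          obtain ⟨j, hj, hjt⟩ := ht
          obtain ⟨i, rfl⟩ := herange j hj
          refine absurd (mem_iUnion.2 ⟨i, ?_⟩) hzW
          rw [hpiece i]
          exact ⟨hzC', hzC, hjt⟩
      · exact Or.inl ⟨hzC, hzC'⟩
    exact measure_mono_null hsub (measure_union_null hnull
      ((measure_biUnion_null_iff G.countable_toSet).2 fun j _ => KZ.volume_graph_eq_zero (hξ j)))
  · -- `T ⊆ groundLast S ∩ (C × ℝ)`
    rw [hTeq]
    exact fun z hz => ⟨hz.1, hC'C hz.2⟩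
  · -- `T` is semialgebraic
    rw [hTeq]
    exact (Grounding.isSemialgebraic_groundLast hS).inter hC'sa.setOf_init_mem
  · -- `groundLast S ∩ (C × ℝ) \ T` lies in the cylinder over `C \ C'`
    rw [hTeq]
    refine measure_mono_null (fun z hz => ?_) hnull
    exact ⟨hz.1.2, fun h => hz.2 ⟨hz.1.1, h⟩⟩

/-- **Symplectic grounding of the last coordinate** (stub `stub_groundLast`): a `ℚ`-region of
finite area is equivalent to its grounding `{(x, t) | 0 < t < length S_x}` — cylindrical
decomposition adapted to `S` (`IsSemialgebraic.exists_cylindricalDecomposition_holds`); over each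
interval cell every band of `S` is inner (`KZ.ne_zero_and_ne_last_of_bandOver_subset`), the bands
are stacked by `stub_groundCell`, graphs and point-cells are null, the fibre length is the total
width (`KZ.volume_fibre_eq_ofReal_sum`), and the cylinders are glued.  Gluing, transitivity and
the two co-null-subset instances of `E` are hypotheses. [folklore] -/
theorem stub_groundLast :
    ∀ (E : Set (Fin 2 → ℝ) → Set (Fin 2 → ℝ) → Prop),
      (∀ A B : Set (Fin 2 → ℝ), E A B ↔
        ∃ (U : Set (Fin 2 → ℝ)) (Φ : (Fin 2 → ℝ) → (Fin 2 → ℝ)),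
          U ⊆ A ∧ IsSemialgebraic ℚ U ∧ IsOpen U ∧ volume (A \ U) = 0 ∧
          IsSemialgebraicMapOn ℚ U Φ ∧ ContDiffOn ℝ 1 Φ U ∧ InjOn Φ U ∧
          (∀ p ∈ U, |(fderiv ℝ Φ p).det| = 1) ∧ Φ '' U ⊆ B ∧ volume (B \ Φ '' U) = 0) →
    (∀ A₁ A₂ B₁ B₂ : Set (Fin 2 → ℝ), volume (A₁ ∩ A₂) = 0 → Disjoint B₁ B₂ →
      E A₁ B₁ → E A₂ B₂ → E (A₁ ∪ A₂) (B₁ ∪ B₂)) →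
    (∀ A B C : Set (Fin 2 → ℝ), E A B → E B C → E A C) →
    (∀ A A' : Set (Fin 2 → ℝ), A' ⊆ A → IsSemialgebraic ℚ A' → volume (A \ A') = 0 →
      E A A' ∧ E A' A) →
    (∀ (k : ℕ) (C : Set (Fin 1 → ℝ)) (f g : Fin k → (Fin 1 → ℝ) → ℝ),
      IsOpen C → IsSemialgebraic ℚ C →
      (∀ i, IsSemialgebraicFunOn ℚ C (f i)) → (∀ i, IsSemialgebraicFunOn ℚ C (g i)) →
      (∀ i, ContinuousOn (f i) C) → (∀ i, ContinuousOn (g i) C) →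
      (∀ i, ∀ x ∈ C, f i x < g i x) →
      (∀ i i', i < i' → ∀ x ∈ C, g i x ≤ f i' x) →
      E (⋃ i, {z : Fin 2 → ℝ | Fin.init z ∈ C ∧ f i (Fin.init z) < z (Fin.last 1) ∧
            z (Fin.last 1) < g i (Fin.init z)})
        {z : Fin 2 → ℝ | Fin.init z ∈ C ∧ 0 < z (Fin.last 1) ∧
            z (Fin.last 1) < ∑ i, (g i (Fin.init z) - f i (Fin.init z))}) →
    ∀ S : Set (Fin 2 → ℝ), IsSemialgebraic ℚ S → volume S ≠ ⊤ →
      E S (Grounding.groundLast S) := by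
  -- adapted from `KZ.of_sub_of_mem_relations_groundLast`
  -- (Literature/NumberTheory/Transcendental/KZGroundingRelations.lean)
  intro E _ GLUE TRANS SUB CELL S hS hfin
  classical
  obtain ⟨𝒮, l, ξ, hcd, hcont, hξ, hmono, hcells, hfib⟩ :=
    IsSemialgebraic.exists_cylindricalDecomposition.exists_fibre_eq
      (IsSemialgebraic.exists_cylindricalDecomposition_holds (k := ℚ)) hS
  have hpart := hcd.isPartition
  have h𝒮sa := hcd.isSemialgebraic
  have h00 : E ∅ ∅ := (SUB ∅ ∅ (empty_subset _) isSemialgebraic_empty (by simp)).1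
  -- the pieces over the cells
  have hcell : ∀ C : {C // C ∈ 𝒮}, ∃ W T : Set (Fin 2 → ℝ),
      W ⊆ S ∩ {z | Fin.init z ∈ (C : Set (Fin 1 → ℝ))} ∧ IsSemialgebraic ℚ W ∧
      volume ((S ∩ {z | Fin.init z ∈ (C : Set (Fin 1 → ℝ))}) \ W) = 0 ∧
      T ⊆ Grounding.groundLast S ∩ {z | Fin.init z ∈ (C : Set (Fin 1 → ℝ))} ∧
      IsSemialgebraic ℚ T ∧
      volume ((Grounding.groundLast S ∩ {z | Fin.init z ∈ (C : Set (Fin 1 → ℝ))}) \ T) = 0 ∧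
      E W T := fun C =>
    groundLast_cell E SUB CELL hS hfin (h𝒮sa C C.2) (ξ C) (hcont C C.2) (hξ C C.2) (hmono C C.2)
      (hcells C C.2).2 (hfib C C.2)
  choose W T hWsub hWsa hWnull hTsub hTsa hTnull hWT using hcell
  have hdisj : ∀ C C' : {C // C ∈ 𝒮}, C ≠ C' → Disjoint (C : Set (Fin 1 → ℝ)) C' := fun C C' hne =>
    hpart.pairwiseDisjoint C.2 C'.2 fun h => hne (Subtype.ext h)
  have hcov : ∀ x : Fin 1 → ℝ, ∃ C : {C // C ∈ 𝒮}, x ∈ (C : Set (Fin 1 → ℝ)) := fun x => by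
    have hx : x ∈ ⋃₀ (𝒮 : Set (Set (Fin 1 → ℝ))) := by rw [hpart.sUnion_eq_univ]; exact mem_univ _
    obtain ⟨C, hC, hxC⟩ := mem_sUnion.1 hx
    exact ⟨⟨C, hC⟩, hxC⟩
  -- glue the cells
  have hE : E (⋃ C ∈ (Finset.univ : Finset {C // C ∈ 𝒮}), W C)
      (⋃ C ∈ (Finset.univ : Finset {C // C ∈ 𝒮}), T C) := by
    refine groundLast_glue E h00 GLUE W T Finset.univ (fun C _ C' _ hne => ?_)
      (fun C _ C' _ hne => ?_) fun C _ => hWT C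
    · have h : W C ∩ W C' = ∅ := Set.eq_empty_of_forall_notMem fun z hz =>
        (hdisj C C' hne).ne_of_mem (hWsub C hz.1).2 (hWsub C' hz.2).2 rfl
      rw [h, measure_empty]
    · exact Set.disjoint_left.2 fun z hz hz' =>
        (hdisj C C' hne).ne_of_mem (hTsub C hz).2 (hTsub C' hz').2 rfl
  simp only [Finset.mem_univ, iUnion_true] at hE
  -- `S ~ ⋃ W_C`
  have hWS : (⋃ C, W C) ⊆ S := iUnion_subset fun C => (hWsub C).trans inter_subset_left
  have hWsa' : IsSemialgebraic ℚ (⋃ C, W C) := by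
    have h := IsSemialgebraic.biUnion Finset.univ W fun C _ => hWsa C
    simpa only [Finset.mem_univ, iUnion_true] using h
  have hSW : volume (S \ ⋃ C, W C) = 0 := by
    refine measure_mono_null (fun z hz => ?_) (measure_iUnion_null fun C => hWnull C)
    obtain ⟨C, hzC⟩ := hcov (Fin.init z)
    exact mem_iUnion.2 ⟨C, ⟨hz.1, hzC⟩, fun h => hz.2 (mem_iUnion.2 ⟨C, h⟩)⟩
  -- `⋃ T_C ~ groundLast S`
  have hTG : (⋃ C, T C) ⊆ Grounding.groundLast S :=
    iUnion_subset fun C => (hTsub C).trans inter_subset_left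
  have hTsa' : IsSemialgebraic ℚ (⋃ C, T C) := by
    have h := IsSemialgebraic.biUnion Finset.univ T fun C _ => hTsa C
    simpa only [Finset.mem_univ, iUnion_true] using h
  have hGT : volume (Grounding.groundLast S \ ⋃ C, T C) = 0 := by
    refine measure_mono_null (fun z hz => ?_) (measure_iUnion_null fun C => hTnull C)
    obtain ⟨C, hzC⟩ := hcov (Fin.init z)
    exact mem_iUnion.2 ⟨C, ⟨hz.1, hzC⟩, fun h => hz.2 (mem_iUnion.2 ⟨C, h⟩)⟩
  exact TRANS _ _ _ (TRANS _ _ _ (SUB S _ hWS hWsa' hSW).1 hE) (SUB _ _ hTG hTsa' hGT).2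

end Summit.KontsevichZagierPeriods.SymplecticScissors.PlanarSAZylev
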